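import Summits.NavierStokesRegularity.NavierStokesRegularity.Theorems.EulerZoomLiouvillePowerGaugeEulerLiouvilleBackwardVanishing
import HarnessLib

/-!
# The birth cut of `PowerGaugeEulerLiouville` isolates nothing beyond rung A: STUB 3 ≡ the crux
# on the window `0 < ρ ≤ 1/2` (route `EulerZoomLiouville`, crux stmt-NavierStokesRegularity-19832,
# line `birth`)

Helper file (theorems only) — a RESHAPING NOTE for the lead and the critics, kernel-checked.  The
registered line `birth` cuts the crux as `stub_largeRho` (ρ > 1/2, proved) → `stub_backwardVanishing`
(every class member vanishes backward, PROVED: `Backward.stub_backwardVanishing`, p480952) →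
`stub_noCollapseFromZero` (`0 < ρ ≤ 1/2`: a class member that vanishes backward is trivial).  Since
STUB 2 holds for EVERY class member, its conclusion `VanishesBackward u` is a FREE hypothesis in
STUB 3: the registered signature `Sig.stub_noCollapseFromZero` is EQUIVALENT to the crux restricted
to the window `0 < ρ ≤ 1/2` (`noCollapseFromZero_iff_window`), hence — composing with p1's
`powerGaugeEulerLiouville_iff_window` (p476480, `…LargeRho.lean`; not imported here to keep this file
outside the theses cone) — to the crux `EulerZoomLiouville.PowerGaugeEulerLiouville` itself.
So the line has no intermediate statement left between the tree and the open core; a genuine cut of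
STUB 3 must ADD structure (e.g. the in-window rungs C1–C3: self-similar / DSS / axisymmetric-no-swirl
members, or a flux-level hypothesis), not the backward-vanishing conclusion.

* `noCollapseFromZero_iff_window` — `Sig.stub_noCollapseFromZero` (unfolded) ↔ the window crux
  (= the right-hand side of `powerGaugeEulerLiouville_iff_window`, verbatim).

WHAT THIS IS NOT: not NS / Euler and not progress on the crux — a statement about the SHAPE of the
registered skeleton (its residual sorry is crux-sized by construction). [folklore]
-/

noncomputable section

-- the summit and its single problem share the name `NavierStokesRegularity` (D-0017 nested layout)
set_option linter.dupNamespace false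

open MeasureTheory Set Filter Topology Metric Module TopologicalSpace Function
open scoped NNReal ENNReal

namespace Summit.NavierStokesRegularity.NavierStokesRegularity.Theorems.PowerGaugeEulerLiouville.Backward

open Literature.Analysis Literature.Analysis.FunctionSpaces Literature.Analysis.FluidPDE

/-- **STUB 3 of the birth skeleton ≡ the window crux.**  The registered signature
`Sig.stub_noCollapseFromZero` (unfolded: for `0 < ρ ≤ 1/2`, a class member that VANISHES BACKWARD is
a.e. zero) is equivalent to the crux restricted to `0 < ρ ≤ 1/2` (same, WITHOUT the backward-vanishing
hypothesis) — because every class member vanishes backward (`stub_backwardVanishing`). [folklore] -/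
theorem noCollapseFromZero_iff_window :
    (∀ ρ : ℝ, 0 < ρ → ρ ≤ 1 / 2 →
      ∀ (u : ℝ → EuclideanSpace ℝ (Fin 3) → EuclideanSpace ℝ (Fin 3))
        (p : ℝ → EuclideanSpace ℝ (Fin 3) → ℝ)
        (H : ℝ → EuclideanSpace ℝ (Fin 3) → EuclideanSpace ℝ (Fin 3) →L[ℝ] EuclideanSpace ℝ (Fin 3))
        (c : ℝ≥0),
        (IsSuitableWeakSolutionOn (slab (EuclideanSpace ℝ (Fin 3)) (Set.Iio 0) isOpen_Iio) 0 0 u p ∧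
          HasWeakSpatialGradientOn (slab (EuclideanSpace ℝ (Fin 3)) (Set.Iio 0) isOpen_Iio) u H ∧
          (∀ a : ℝ, 0 < a →
            ENNReal.ofReal (a ^ (2 * ρ)) * cknA a (0 : ℝ × EuclideanSpace ℝ (Fin 3)) u +
              ENNReal.ofReal (a ^ ρ) * cknE a (0 : ℝ × EuclideanSpace ℝ (Fin 3)) H +
              ENNReal.ofReal (a ^ (2 * ρ)) * cknD a (0 : ℝ × EuclideanSpace ℝ (Fin 3)) p ≤ (c : ℝ≥0∞))) →
        (∀ R ε : ℝ, 0 < R → 0 < ε →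
          Tendsto (fun a : ℝ =>
              volume {τ : ℝ | τ ∈ Set.Ioo (-(a ^ 2)) 0 ∧
                  ENNReal.ofReal ε < ∫⁻ y in ball (0 : EuclideanSpace ℝ (Fin 3)) R, ‖u τ y‖ₑ ^ 2} /
                ENNReal.ofReal (a ^ 2))
            atTop (𝓝 0)) →
        Function.uncurry u =ᵐ[volume.restrict (Set.Iio (0 : ℝ) ×ˢ (Set.univ : Set (EuclideanSpace ℝ (Fin 3))))] 0) ↔
    (∀ ρ : ℝ, 0 < ρ → ρ ≤ 1 / 2 →
      ∀ (u : ℝ → EuclideanSpace ℝ (Fin 3) → EuclideanSpace ℝ (Fin 3))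
        (p : ℝ → EuclideanSpace ℝ (Fin 3) → ℝ)
        (H : ℝ → EuclideanSpace ℝ (Fin 3) → EuclideanSpace ℝ (Fin 3) →L[ℝ] EuclideanSpace ℝ (Fin 3))
        (c : ℝ≥0),
        IsSuitableWeakSolutionOn (slab (EuclideanSpace ℝ (Fin 3)) (Set.Iio 0) isOpen_Iio) 0 0 u p →
        HasWeakSpatialGradientOn (slab (EuclideanSpace ℝ (Fin 3)) (Set.Iio 0) isOpen_Iio) u H →
        (∀ a : ℝ, 0 < a →
          ENNReal.ofReal (a ^ (2 * ρ)) * cknA a (0 : ℝ × EuclideanSpace ℝ (Fin 3)) u +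
            ENNReal.ofReal (a ^ ρ) * cknE a (0 : ℝ × EuclideanSpace ℝ (Fin 3)) H +
            ENNReal.ofReal (a ^ (2 * ρ)) * cknD a (0 : ℝ × EuclideanSpace ℝ (Fin 3)) p ≤ (c : ℝ≥0∞)) →
        Function.uncurry u =ᵐ[volume.restrict (Set.Iio (0 : ℝ) ×ˢ (Set.univ : Set (EuclideanSpace ℝ (Fin 3))))] 0) := by
  constructor
  · intro h ρ hρ hρ2 u p H c hsw hH hc
    exact h ρ hρ hρ2 u p H c ⟨hsw, hH, hc⟩ (stub_backwardVanishing ρ hρ u p H c ⟨hsw, hH, hc⟩)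
  · intro h ρ hρ hρ2 u p H c hcl _
    exact h ρ hρ hρ2 u p H c hcl.1 hcl.2.1 hcl.2.2

end Summit.NavierStokesRegularity.NavierStokesRegularity.Theorems.PowerGaugeEulerLiouville.Backward

end
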